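import Mathlib.Tactic
import Literature.Geometry.Lorentzian.KlainermanSzeftel2021.GCMHRungLedger

/-!
# Theorem M7 (extension of GCM admissible spacetimes): the printed derivative budget of [KS] §8.5, Steps 1–18

CITATION HEADER (lean-in-tree rule 2026-08-18).  Kernel-checked transcription of INTEGER BOOKKEEPING printed in
* [KS] S. Klainerman, J. Szeftel, *Kerr stability for small angular momentum*, Pure Appl. Math. Q. **19** (2023) no. 3, 791–1678
  = bib key `KlainermanSzeftel2023`, read as the authors' accepted version HAL hal-04280491 (`HAL p.N Ln` = PDF page N, text line n;
  printed page = N − 1), AND as the e-print arXiv:2104.11857v1 = bib key `KlainermanSzeftel2021` (TeX `Main-Kerr-arxiv.tex`, `v1 l.N`);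
  the two texts print the SAME levels at every locus quoted below unless a `[J]`-delta is stated;
* [GCM2] S. Klainerman, J. Szeftel, *Effective results on uniformization and intrinsic GCM spheres in perturbations of Kerr*,
  Ann. PDE **8** (2022) no. 18 = bib key `KlainermanSzeftel2022` (arXiv:1912.12195, TeX `main.tex`, `GCM2 l.N`) — only Thm 7.3's
  conclusion (ThmGCMS4) "‖(U,S)‖_{𝔥_s(S̊)} ≲ r δ̊ for s ≤ s_max + 1" (GCM2 l.3240–3244) and Prop 4.15 (output `𝔥_s` / `𝔥_{s+1}` from an
  `H^s` hypothesis), both as restated in [KS] (Thm 8.1.7 item 2, HAL p.458 L39–46 = v1 l.18183–18186; Prop 5.1.5 [J] = v1 l.9244–9262);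
* [Sh] D. Shen, *Construction of GCM hypersurfaces in perturbations of Kerr*, Ann. PDE **9**:11 (2023) = bib key `Shen2023GCM` —
  only Thm 4.1 item 7 / Cor 4.2 as restated in [KS] (Thm 8.1.11 (8.1.49), HAL p.463 L10–13 = v1 Thm 8.1.10, l.18366–18368:
  "‖𝔡^{≤s_max+1}(f, f̲, λ−1)‖_{L²(S)} ≲ δ̊"; Cor 8.1.12 [J] = Cor 8.1.11 v1), and the hypothesis orders (4.1)–(4.2) `s_max + 1` versus
  [KS] (8.1.34)–(8.1.35) `s_max` already ledgered in `GCMHRungLedger` (audit-cell finding E11(b)-J), which this file IMPORTS and re-reads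
  at the Theorem-M7 application.
DISPLAY NUMBERS.  Every `(8.5.N)` in this file is the number printed in the refereed text [J] = HAL hal-04280491 (bib key
`KlainermanSzeftel2023`); the e-print is cited by TeX line and `\label` only, because arXiv v1 numbers §8.5 differently (counted from
the TeX: 66 numbered displays in v1 l.21593–23066 against 68 in [J]): [J] adds (8.5.9) (Step 4: `sup_R̃(|𝔡̂^k(r − s)| +
|𝔡̂^{k−1}(e₃(r) − e₃(s))| + |𝔡̂^{k−1}(e₄(r) − e₄(s))|) ≲ ε₀Δ_ext/r` "for all k ≤ k_* − 3", HAL p.555 L1–22), drops the e-print's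
zeroth-order `sup_R̃|r − s|` display (v1 (8.5.36), `…newlastGCMS:3`, l.22219) and its Step-15 derivative version (v1 (8.5.45),
`eq:controlofrminussonwidetildeRRhigherorderderivatives:ThmM7`, l.22502, also "for k ≤ k_* − 3"), and rewrites Step 15 around
Lemma 8.1.13 ((8.5.44) `b_* := b̃_* + e₃(u) + e₃(s)`, (8.5.45), (8.5.46), (8.5.48) have no e-print number).  Concordance for the
displays quoted here: [J] (8.5.1), (8.5.2), (8.5.3), (8.5.5), (8.5.6) = v1 (8.5.1), (8.5.2), (8.5.3), (8.5.5), (8.5.6); [J] (8.5.19),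
(8.5.20), (8.5.22) = v1 (8.5.18), (8.5.19), (8.5.21); [J] (8.5.41) = v1 (8.5.41); [J] (8.5.58) = v1 (8.5.56); [J] (8.5.68) = v1
(8.5.66).  The LEVELS `k_* − j` printed at corresponding loci agree (the [J] rewrite of Steps 4/15 changes weights — (8.5.6) prints
`r³|𝔡̂^k(μ̌ − …)|` where v1 l.21684 prints `r²|𝔡^k(μ̌ − …)|` — and intermediate Step-15/16 levels, never an endpoint of the chain).

WHAT IS TRANSCRIBED.  [KS] §8.5 proves Theorem M7 in 18 steps with the notation "k_* := k_small + 20" ((8.5.1), HAL p.551 L23 = v1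
l.21615) from the hypothesis "𝔑^{(Dec)}_{k_*}(ℳ) ≤ Cε₀" ((8.5.2), p.551 L26 = v1 l.21620) down to "𝔑^{(Dec)}_{k_*−12}(ℳ̃) ≲ ε₀.  In particular,
since k_* = k_small + 20, we infer 𝔑^{(Dec)}_{k_small}(ℳ̃) ≲ ε₀ which concludes the proof of Theorem M7" (HAL p.592 L48–53 = v1 l.23047–23051).
The displayed intermediate levels (each `def` below carries its locus): Step 1 local existence `k_* − 3` (loss 3, "local existence holds
in L² based spaces while 𝔑^{(Dec)}_k is based on L^∞", HAL p.552 L3–6 fn 32 = v1 l.21631–21633); Step 4 transported GCM quantities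
(8.5.6) `k ≤ k_* − 4` (p.553 L42–71 = v1 l.21681–21685); Step 5 uniformized metric and `φ` at `k ≤ k_* − 3`, canonical modes
`‖J^{(p)} − J^{(p,S)}‖_{𝔥_{k_*−2}(S)}` ((8.5.22), p.560 L70–76 = v1 l.21929), `e₃(J^{(p)})` at `k ≤ k_* − 3` (v1 l.21946); Steps 6 and 7 apply [GCM2]
Thm 7.3 / Cor 7.7 and [Sh] Thm 4.1 "with s_max = k_small + k_* − 4" (VERBATIM, twice: HAL p.562 L54 and p.563 L2 = v1 l.21990 and
l.22010) and display the frame coefficients `(f, f̲, log λ) ∈ 𝔥_{k_*−3}(S̃)` (p.563 L31–35 = v1 l.22041); Step 14 "Corollary 4.2 in [50]"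
gives `𝔡^{≤k_*−3}(f, f̲, log λ) ∈ L²(S̃)` then Sobolev `sup r̃|𝔡^{≤k_*−5}(…)|` ((8.5.41), p.573 L17–25 = v1 l.22391–22397); the descent
of Steps 14–17 ends at `k ≤ k_* − 9` (p.590–592 = v1 l.22948–23021); Step 17 displays the deformation `(U, S) ∈ 𝔥_{k_*−2}(S̊)`
((8.5.58), p.586 L26–30 = v1 l.22835–22837) and concludes from it, via Prop 4.15 and Sobolev, a `sup` bound "for k ≤ k_* − 6" (p.586
L43–50 = v1 l.22840–22846); Step 18: `(int)/(top)` at `k ≤ k_* − 10` ((8.5.68), p.592 L33–41 = v1 l.23034), final `k_* − 12`.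
`[J]`-deltas (not typed, see DISPLAY NUMBERS above): [J] inserts Lemma 8.1.13 at Step 15 as (8.5.45) (p.575 L38–49, printed
with the lemma's own index "𝔥_{s_max−j}" at local `s_max := k ≤ k_* − 5`), with locally different intermediate Step-15/16 levels
(p.575–580: (8.5.48) `sup r^{−1}|𝔡̃^k(r̃ − r)| ≲ ε₀δ_ext` "for k ≤ k_* − 9", where v1 (8.5.44), l.22483, has it for `k ≤ k_* − 4`)
but the SAME endpoints `k_* − 5 → k_* − 9` ((8.5.49) = v1 (8.5.47) `…:ter`, both "for k ≤ k_* − 9", p.580 L14–23 = v1 l.22642–22645);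
and [J] moves the derivative control of `r − s` on `R̃` (level `k_* − 3` in both texts) from Step 15 to Step 4 as (8.5.9).

WHAT IS CERTIFIED (ℕ arithmetic only; every `theorem` is decided by `omega` / `decide` after unfolding).  (1) The printed chain is
monotone with the printed losses and ends at `k_* − 12 = k_small + 8 ≥ k_small`: Theorem M7's budget closes with SLACK 8
(`final_ge_target`), so any cumulative extra loss `≤ 8` anywhere in §8.5 is absorbed (`extra_loss_absorbed`).  (2) DATUM (i), the value of
`s_max`: the printed "k_small + k_* − 4" (= 2k_small + 16) exceeds, for `k_small ≥ 1`, the order `k_* − 4` SUPPLIED by (8.5.6) to the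
hypotheses (8.1.23) `sup_R|𝔡̸^{≤s_max}(κ̇, κ̲̇)| ≲ r^{−2}δ̊, sup_R|𝔡̸^{≤s_max}μ̇| ≲ r^{−3}δ̊` (angular `𝔡̸`, HAL p.457 L71–73) / (8.1.35) (the
same with `𝔡̂`, HAL p.461 L1–6) and, for `k_small ≥ 2`, even Step 1's `k_* − 3` = everything available on
ℳ^(extend) (`smaxPrinted_unsupported`); the reading `s_max = k_* − 4` is the UNIQUE value compatible with both the supplied hypothesis
order and the displayed output order `s_max + 1 = k_* − 3` of Step 7 / Step 14 (`smaxConsistent_fits`, `smax_unique`), and the two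
readings agree only at `k_small = 0` (`smaxPrinted_eq_consistent_iff`).  (3) DATUM (ii), E11(b)-J AT THEOREM M7: with `s_max = k_* − 4`,
[KS]'s restated demand (8.1.35) is met by (8.5.6) exactly and [Sh]'s printed demand (4.2) `s_max + 1 = k_* − 3` is one above (8.5.6)
(and equal to Step 1's level); [Sh] (4.1) on `e₃(J^{(p)})` is met exactly (`e11b_at_M7`); USE-LEVEL, Step 14 reads Shen's hierarchy
only up to rung `K − 2` (`K = s_max + 1 = k_* − 3`, Sobolev cost 2, top read index `k_* − 5`) — the M6 pattern of `GCMHRungLedger`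
verbatim, so every read rung is covered at order `s_max` (`m7_reads_rungs_le`, `m7_rungs_covered`); BUDGET-LEVEL, unlike Theorem M6
(slack 0: `GCMHRungLedger.repair_indices`), even the index repair "lower s_max by one" is free at M7 (`m7_vs_m6_slack`).  (4) DATUM
(iii): the Step-17 display `(U,S) ∈ 𝔥_{k_*−2}(S̊)` is `s_max + 2`, ONE above [GCM2] Thm 7.3's `s_max + 1` under the consistent reading
(`us_display_excess`); it is not load-bearing: fed with `𝔥_{s_max+1} = 𝔥_{k_*−3}` instead, Prop 4.15 (metric pull-back costs one
derivative of `(U,S)`) and Sobolev land exactly on the printed "k ≤ k_* − 6", while the displayed `k_* − 2` would give `k_* − 5`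
(`us_chain_supplied`, `us_chain_displayed`: local slack 1).

STATUS / RELATION.  [KS], [GCM2], [Sh] are refereed publications; data (i) and (iii) are print-level (the same words in the e-print and
in the refereed text), recorded with the reading under which every display of §8.5 closes — NOT adjudicated beyond the integers; datum
(ii) is the Theorem-M7 row of the E11(b)-J use-site census (audit cell `pub-kerr`, GAPS.md blocks 22/24/27).  Companion of
`RecoveryScheme` (Thm M5 budget), `GCMHRungLedger` (Thm M6 / Shen junction) and of `Bootstrap.ImprovedDecay` (index `k_small + 20`) →
`Bootstrap.IsM7Extension.dec` (index `k_small`), whose 20-derivative drop this file itemises.  NOTHING analytic is asserted: no estimate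
of [KS], [GCM2] or [Sh] is formalised, only the indices they print.  Mathlib + `GCMHRungLedger` only.  Not Final-State-Conjecture progress.
-/

namespace Literature.Geometry.Lorentzian.KlainermanSzeftel2021.ExtensionRegularityLedger

/-! ## §1 The printed chain (argument `ks` = k_small) -/

/-- `k_* := k_small + 20`. [cite: KlainermanSzeftel2023, (8.5.1), HAL hal-04280491 p.551 L23; KlainermanSzeftel2021, (8.5.1) v1, TeX l.21615] -/
def kStar (ks : ℕ) : ℕ := ks + 20

/-- Hypothesis level: `𝔑^{(Dec)}_{k_*}(ℳ) ≤ Cε₀`. [cite: KlainermanSzeftel2023, (8.5.2), HAL p.551 L26–27; KlainermanSzeftel2021, (8.5.2) v1 `Fullestimates:onMM`, l.21618–21620] -/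
def hypLevel (ks : ℕ) : ℕ := kStar ks

/-- Step 1: loss of three derivatives by local existence ("L² based spaces while 𝔑^{(Dec)}_k is based on L^∞").
[cite: KlainermanSzeftel2023, §8.5.1 Step 1 fn 32, HAL p.552 L3–6; KlainermanSzeftel2021, l.21631–21633] -/
def localExistenceLoss : ℕ := 3

/-- Step 1: `𝔑^{(Dec)}_{k_*−3}(ℳ^(extend)) ≤ 2Cε₀` — everything available on the extended spacetime.
[cite: KlainermanSzeftel2023, HAL p.552 L5–6; KlainermanSzeftel2021, l.21633] -/
def extendLevel (ks : ℕ) : ℕ := kStar ks - 3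

/-- Step 4: transport along `e₄` from `Σ_*^(extend)` costs one derivative (`𝔡^k e₄(κ̲̌)` involves `𝔡^{k+1}` of the Ricci coefficients).
[cite: KlainermanSzeftel2023, (8.5.5)–(8.5.6), HAL p.553 L13–71; KlainermanSzeftel2021, (8.5.5)–(8.5.6) v1, l.21669–21685] -/
def transportLoss : ℕ := 1

/-- (8.5.6): `sup_{R̃}(r²|𝔡̂^k κ̌| + r²|𝔡̂^k(κ̲̌ − (…))| + r³|𝔡̂^k(μ̌ − (…))|) ≲ ε₀Δ_ext/r` "for all k ≤ k_* − 4" ([J] weights; v1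
l.21684 prints `r²` on the `μ̌` term and `𝔡` for `𝔡̂`) — the SUPPLY for the hypotheses `sup_R|𝔡̸^{≤s_max}(κ̇, κ̲̇)| ≲ r^{−2}δ̊`,
`sup_R|𝔡̸^{≤s_max}μ̇| ≲ r^{−3}δ̊` ((8.1.23) of Thm 8.1.7, angular `𝔡̸`, HAL p.457 L68–78) and the same with the tangential `𝔡̂`
((8.1.35) of Thm 8.1.11, HAL p.460 L60 – p.461 L6); `𝔡̂ ⊇ 𝔡̸`, so (8.5.6) at order `k_* − 4` serves both at `s_max = k_* − 4`.
[cite: KlainermanSzeftel2023, (8.5.6), HAL p.553 L42–71; KlainermanSzeftel2021, (8.5.6) v1 `eq:controlofthesmallGCMquantitieskackabcmucforThmM7`, l.21681–21685] -/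
def gcmLevel (ks : ℕ) : ℕ := kStar ks - 4

/-- Step 5: uniformized metric (8.5.19) and conformal factor `φ` (8.5.20) at `k ≤ k_* − 3`.
[cite: KlainermanSzeftel2023, (8.5.19) HAL p.559 L86 and (8.5.20) p.560 L18; KlainermanSzeftel2021, = v1 (8.5.18) l.21892 and (8.5.19) l.21901 (`…forJnearcanonical1/2`), quantifiers l.21866–21900] -/
def unifLevel (ks : ℕ) : ℕ := kStar ks - 3

/-- [GCM2] Prop 4.15 (restated [KS] Prop 5.1.5): from an `H^s` metric hypothesis, the conformal factors differ in `𝔥_s` and the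
canonical `ℓ = 1` modes in `𝔥_{s+1}` — a GAIN of one on `J`. [cite: KlainermanSzeftel2022, Prop 4.15; KlainermanSzeftel2021, l.9244–9262] -/
def prop415GainJ : ℕ := 1

/-- Step 5: `max_p r^{−1}‖J^{(p)} − J^{(p,S)}‖_{𝔥_{k_*−2}(S)} ≲ ε₀Δ_ext/r²` (Prop 4.15 at `s = k_* − 3`).
[cite: KlainermanSzeftel2023, (8.5.22), HAL p.560 L70–76; KlainermanSzeftel2021, = v1 (8.5.21) `…forJnearcanonical4`, l.21926–21929] -/
def jCanonLevel (ks : ℕ) : ℕ := kStar ks - 2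

/-- Step 5: `|𝔡^k e₃(J^{(p)})| ≲ …Δ_ext` on `R̃` "for all k ≤ k_* − 3" — the supply for (8.1.34) / [Sh] (4.1).
[cite: KlainermanSzeftel2021, `eq:controlofthesmalle3JpforThmM7`, l.21946–21949; KlainermanSzeftel2023, HAL p.561 L16–24] -/
def e3JLevel (ks : ℕ) : ℕ := kStar ks - 3

/-- Steps 6 and 7 VERBATIM: "with s_max = k_small + k_* − 4" (applying [GCM2] Thm 7.3 / Cor 7.7, resp. [Sh] Thm 4.1).
[cite: KlainermanSzeftel2023, §8.5 Step 6 HAL p.562 L54 and Step 7 p.563 L2; KlainermanSzeftel2021, l.21990 and l.22010] -/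
def smaxPrinted (ks : ℕ) : ℕ := ks + kStar ks - 4

/-- The reading under which every display of §8.5 closes: `s_max = k_* − 4` (see `smax_unique`). [folklore] -/
def smaxConsistent (ks : ℕ) : ℕ := kStar ks - 4

/-- Order of `(κ̇, κ̲̇, μ̇)` demanded by the [KS] restatements (8.1.23) / (8.1.35): `s_max` (= `GCMHRungLedger.supplyKS`).
[cite: KlainermanSzeftel2023, (8.1.23) HAL p.457 L68–78, (8.1.35) p.461 L5–13] -/
def hypOrderKS (smax : ℕ) : ℕ := smax

/-- Order of `(κ̇, κ̲̇, μ̇)` and of `e₃(J^{(p)})` demanded by [Sh] (4.1)–(4.2) as printed: `s_max + 1` (= `GCMHRungLedger.supplyShen`).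
[cite: Shen2023GCM, (4.1)–(4.2), arXiv v2 TeX l.1773–1785] -/
def hypOrderShen (smax : ℕ) : ℕ := smax + 1

/-- A4-Strong (8.1.19): `‖J^{(p)} − J^{(p,S̊)}‖_{𝔥_{s_max+1}(S̊)} ≲ δ̊` — order `s_max + 1`.
[cite: KlainermanSzeftel2023, A4-Strong item 2 (8.1.19), HAL p.456 L67–80; KlainermanSzeftel2021, l.18111–18113] -/
def a4StrongOrder (smax : ℕ) : ℕ := smax + 1

/-- [Sh] Thm 4.1 item 7 / Cor 4.2 as restated ([KS] (8.1.49), (8.1.56)): `(f, f̲, λ − 1)` with `𝔡^{≤ s_max+1}` in `L²(S)` — order `s_max + 1`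
(= `GCMHRungLedger.K`). [cite: KlainermanSzeftel2023, (8.1.49) HAL p.463 L10–13, (8.1.56) p.464 L6–10; KlainermanSzeftel2021, l.18366–18368] -/
def frameOutOrder (smax : ℕ) : ℕ := smax + 1

/-- [GCM2] Thm 7.3 conclusion (ThmGCMS4) = [KS] Thm 8.1.7 item 2: `‖(U,S)‖_{𝔥_{s_max+1}(S̊)} ≲ r δ̊` — order `s_max + 1`.
[cite: KlainermanSzeftel2022, Thm 7.3 (l.3807–3830) with (ThmGCMS4) of Thm [Theorem:ExistenceGCMS1] §6, arXiv TeX l.3240–3244; KlainermanSzeftel2023, Thm 8.1.7 item 2, HAL p.458 L39–46; KlainermanSzeftel2021, l.18183–18186] -/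
def usOutOrder (smax : ℕ) : ℕ := smax + 1

/-- Steps 7, 9–13: `‖(f, f̲, log λ)‖_{𝔥_{k_*−3}(S̃)}` (displayed seven times), and Step 14's `𝔡^{≤k_*−3}(f, f̲, log λ) ∈ L²(S̃)`.
[cite: KlainermanSzeftel2023, HAL p.563 L31–35, p.573 L17–21; KlainermanSzeftel2021, l.22041, l.22060, l.22159–22191, l.22391–22393] -/
def frameLevel (ks : ℕ) : ℕ := kStar ks - 3

/-- Step 14 (8.5.41): Sobolev on the spheres `S̃` — `sup r̃|𝔡^{≤k_*−5}(f, f̲, log λ)| ≲ ε₀δ_ext` (cost `GCMHRungLedger.sobolevCost = 2`).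
[cite: KlainermanSzeftel2023, (8.5.41), HAL p.573 L22–25; KlainermanSzeftel2021, = v1 (8.5.41) `…newlastGCMS:4:thereturn`, l.22395–22397] -/
def supLevel14 (ks : ℕ) : ℕ := kStar ks - 5

/-- Steps 14–17: the displayed descent `k_*−5 → k_*−6 → k_*−7 → k_*−8 → k_*−9` (transport along `ν̃`, Poincaré, commutations); its end level.
[cite: KlainermanSzeftel2021, l.22397–22643 and (Step 17) l.22948–22969; KlainermanSzeftel2023, HAL p.573–580 and p.590 L4 – p.592 L17] -/
def extLevel (ks : ℕ) : ℕ := kStar ks - 9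

/-- Step 17 (8.5.58): "the scalar functions U and S on S̊ satisfy `r^{−1}‖(U,S)‖_{𝔥_{k_*−2}(S̊)} ≲ ε₀δ_ext`" — displayed order `k_* − 2`.
[cite: KlainermanSzeftel2023, (8.5.58), HAL p.586 L23–30; KlainermanSzeftel2021, = v1 (8.5.56) `eq:controlofdeformationfunctionsUandS:ThmM7`, l.22830–22837] -/
def usDisplayed (ks : ℕ) : ℕ := kStar ks - 2

/-- Step 17: the metric pull-back `(Ψ^{−1})^# g` costs one derivative of `(U,S)` before Prop 4.15 is applied (output `φ̃ − φ∘Ψ^{−1} ∈ 𝔥_s`).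
[cite: KlainermanSzeftel2023, HAL p.586 L31–45; KlainermanSzeftel2021, l.22838–22841] -/
def pullbackLoss : ℕ := 1

/-- Step 17: "Together with Sobolev, we deduce from the above, for `k ≤ k_* − 6`" — the only quantitative consumer of (8.5.58).
[cite: KlainermanSzeftel2023, HAL p.586 L50–60; KlainermanSzeftel2021, l.22846–22849] -/
def step17SupLevel (ks : ℕ) : ℕ := kStar ks - 6

/-- Step 18 (8.5.68): `(int)ℳ̃` and `(top)ℳ̃` at `k ≤ k_* − 10`. [cite: KlainermanSzeftel2023, (8.5.68), HAL p.592 L33–42; KlainermanSzeftel2021, = v1 (8.5.66) `eq:controlffblaonMintwidetildeThmM7`, l.23034–23040] -/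
def intTopLevel (ks : ℕ) : ℕ := kStar ks - 10

/-- Step 18: `𝔑^{(Dec)}_{k_*−12}(ℳ̃) ≲ ε₀`. [cite: KlainermanSzeftel2023, HAL p.592 L45–49; KlainermanSzeftel2021, l.23040–23047] -/
def finalLevel (ks : ℕ) : ℕ := kStar ks - 12

/-- Theorem M7's conclusion level: `𝔑^{(Dec)}_{k_small}(ℳ̃) ≲ ε₀` (= `Bootstrap.IsM7Extension.dec`).
[cite: KlainermanSzeftel2023, HAL p.592 L50–53 and Thm M7 p.159 L25–33; KlainermanSzeftel2021, l.23049–23051] -/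
def targetLevel (ks : ℕ) : ℕ := ks

/-- Printed slack of Theorem M7's budget: `(k_* − 12) − k_small`. [folklore] -/
def slack (ks : ℕ) : ℕ := finalLevel ks - targetLevel ks

/-- Unfolding lemma. [folklore] -/
@[simp] lemma kStar_def (ks : ℕ) : kStar ks = ks + 20 := rfl
/-- Unfolding lemma. [folklore] -/
@[simp] lemma hypLevel_def (ks : ℕ) : hypLevel ks = kStar ks := rfl
/-- Unfolding lemma. [folklore] -/
@[simp] lemma localExistenceLoss_def : localExistenceLoss = 3 := rfl
/-- Unfolding lemma. [folklore] -/
@[simp] lemma extendLevel_def (ks : ℕ) : extendLevel ks = kStar ks - 3 := rfl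
/-- Unfolding lemma. [folklore] -/
@[simp] lemma transportLoss_def : transportLoss = 1 := rfl
/-- Unfolding lemma. [folklore] -/
@[simp] lemma gcmLevel_def (ks : ℕ) : gcmLevel ks = kStar ks - 4 := rfl
/-- Unfolding lemma. [folklore] -/
@[simp] lemma unifLevel_def (ks : ℕ) : unifLevel ks = kStar ks - 3 := rfl
/-- Unfolding lemma. [folklore] -/
@[simp] lemma prop415GainJ_def : prop415GainJ = 1 := rfl
/-- Unfolding lemma. [folklore] -/
@[simp] lemma jCanonLevel_def (ks : ℕ) : jCanonLevel ks = kStar ks - 2 := rfl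
/-- Unfolding lemma. [folklore] -/
@[simp] lemma e3JLevel_def (ks : ℕ) : e3JLevel ks = kStar ks - 3 := rfl
/-- Unfolding lemma. [folklore] -/
@[simp] lemma smaxPrinted_def (ks : ℕ) : smaxPrinted ks = ks + kStar ks - 4 := rfl
/-- Unfolding lemma. [folklore] -/
@[simp] lemma smaxConsistent_def (ks : ℕ) : smaxConsistent ks = kStar ks - 4 := rfl
/-- Unfolding lemma. [folklore] -/
@[simp] lemma hypOrderKS_def (smax : ℕ) : hypOrderKS smax = smax := rfl
/-- Unfolding lemma. [folklore] -/
@[simp] lemma hypOrderShen_def (smax : ℕ) : hypOrderShen smax = smax + 1 := rfl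
/-- Unfolding lemma. [folklore] -/
@[simp] lemma a4StrongOrder_def (smax : ℕ) : a4StrongOrder smax = smax + 1 := rfl
/-- Unfolding lemma. [folklore] -/
@[simp] lemma frameOutOrder_def (smax : ℕ) : frameOutOrder smax = smax + 1 := rfl
/-- Unfolding lemma. [folklore] -/
@[simp] lemma usOutOrder_def (smax : ℕ) : usOutOrder smax = smax + 1 := rfl
/-- Unfolding lemma. [folklore] -/
@[simp] lemma frameLevel_def (ks : ℕ) : frameLevel ks = kStar ks - 3 := rfl
/-- Unfolding lemma. [folklore] -/
@[simp] lemma supLevel14_def (ks : ℕ) : supLevel14 ks = kStar ks - 5 := rfl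
/-- Unfolding lemma. [folklore] -/
@[simp] lemma extLevel_def (ks : ℕ) : extLevel ks = kStar ks - 9 := rfl
/-- Unfolding lemma. [folklore] -/
@[simp] lemma usDisplayed_def (ks : ℕ) : usDisplayed ks = kStar ks - 2 := rfl
/-- Unfolding lemma. [folklore] -/
@[simp] lemma pullbackLoss_def : pullbackLoss = 1 := rfl
/-- Unfolding lemma. [folklore] -/
@[simp] lemma step17SupLevel_def (ks : ℕ) : step17SupLevel ks = kStar ks - 6 := rfl
/-- Unfolding lemma. [folklore] -/
@[simp] lemma intTopLevel_def (ks : ℕ) : intTopLevel ks = kStar ks - 10 := rfl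
/-- Unfolding lemma. [folklore] -/
@[simp] lemma finalLevel_def (ks : ℕ) : finalLevel ks = kStar ks - 12 := rfl
/-- Unfolding lemma. [folklore] -/
@[simp] lemma targetLevel_def (ks : ℕ) : targetLevel ks = ks := rfl
/-- Unfolding lemma. [folklore] -/
@[simp] lemma slack_def (ks : ℕ) : slack ks = finalLevel ks - targetLevel ks := rfl

/-! ## §2 The chain closes with eight derivatives of printed slack -/

/-- The printed levels in closed form (`k_small + n`). [cite: KlainermanSzeftel2023, §8.5, HAL p.551–592] -/
theorem chain_values (ks : ℕ) :
    hypLevel ks = ks + 20 ∧ extendLevel ks = ks + 17 ∧ gcmLevel ks = ks + 16 ∧ unifLevel ks = ks + 17 ∧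
    jCanonLevel ks = ks + 18 ∧ e3JLevel ks = ks + 17 ∧ frameLevel ks = ks + 17 ∧ supLevel14 ks = ks + 15 ∧
    extLevel ks = ks + 11 ∧ intTopLevel ks = ks + 10 ∧ finalLevel ks = ks + 8 := by
  refine ⟨?_, ?_, ?_, ?_, ?_, ?_, ?_, ?_, ?_, ?_, ?_⟩ <;>
    simp only [hypLevel_def, extendLevel_def, gcmLevel_def, unifLevel_def, jCanonLevel_def, e3JLevel_def, frameLevel_def,
      supLevel14_def, extLevel_def, intTopLevel_def, finalLevel_def, kStar_def] <;> omega

/-- Each displayed level is the previous one minus the displayed loss: Step 1 (−3), Step 4 (−1), Step 5's `J` (+1 = Prop 4.15's gain over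
the metric level), Step 14 Sobolev (−2 from the frame level), Steps 14–17 (−4), Step 18 (−1, then −2).
[cite: KlainermanSzeftel2023, §8.5, HAL p.552, 553, 560, 573, 590–592] -/
theorem chain_steps (ks : ℕ) :
    extendLevel ks = hypLevel ks - localExistenceLoss ∧ gcmLevel ks = extendLevel ks - transportLoss ∧
    jCanonLevel ks = unifLevel ks + prop415GainJ ∧ unifLevel ks = extendLevel ks ∧ e3JLevel ks = extendLevel ks ∧
    supLevel14 ks = frameLevel ks - GCMHRungLedger.sobolevCost ∧ extLevel ks = supLevel14 ks - 4 ∧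
    intTopLevel ks = extLevel ks - 1 ∧ finalLevel ks = intTopLevel ks - 2 := by
  refine ⟨?_, ?_, ?_, ?_, ?_, ?_, ?_, ?_, ?_⟩ <;>
    simp only [hypLevel_def, extendLevel_def, gcmLevel_def, unifLevel_def, jCanonLevel_def, e3JLevel_def, frameLevel_def,
      supLevel14_def, extLevel_def, intTopLevel_def, finalLevel_def, kStar_def, localExistenceLoss_def, transportLoss_def,
      prop415GainJ_def, GCMHRungLedger.sobolevCost_def] <;> omega

/-- **Theorem M7's printed budget closes**: `k_* − 12 = k_small + 8 ≥ k_small`, slack exactly 8 ("since k_* = k_small + 20").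
[cite: KlainermanSzeftel2023, HAL p.592 L48–53; KlainermanSzeftel2021, l.23047–23051] -/
theorem final_ge_target (ks : ℕ) : targetLevel ks ≤ finalLevel ks ∧ slack ks = 8 := by
  simp only [targetLevel_def, finalLevel_def, slack_def, kStar_def]; omega

/-- Any cumulative extra loss of at most eight derivatives anywhere along §8.5 still lands on `k_small`. [folklore] -/
theorem extra_loss_absorbed (ks d : ℕ) (hd : d ≤ 8) : targetLevel ks ≤ finalLevel ks - d := by
  simp only [targetLevel_def, finalLevel_def, kStar_def]; omega

/-! ## §3 Datum (i): the printed value of `s_max` -/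

/-- **The consistent reading fits every display**: with `s_max = k_* − 4`, (a) the hypothesis order `s_max` of (8.1.23)/(8.1.35) IS the
supply (8.5.6); (b) A4-Strong's `s_max + 1` is within Step 5's `𝔥_{k_*−2}` (slack 1); (c) Step 7's displayed output `𝔥_{k_*−3}` IS item 7's
`s_max + 1`, and Step 14's `𝔡^{≤k_*−3} ∈ L²` IS Cor 4.2's `s_max + 1`; (d) `e₃(J^{(p)})`: the [KS] demand `s_max` and the [Sh] demand
`s_max + 1` are both within Step 5's `k_* − 3`. [cite: KlainermanSzeftel2023, HAL p.457–463, p.553, p.560–563, p.573] -/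
theorem smaxConsistent_fits (ks : ℕ) :
    hypOrderKS (smaxConsistent ks) = gcmLevel ks ∧
    a4StrongOrder (smaxConsistent ks) ≤ jCanonLevel ks ∧ a4StrongOrder (smaxConsistent ks) + 1 = jCanonLevel ks ∧
    frameOutOrder (smaxConsistent ks) = frameLevel ks ∧
    hypOrderKS (smaxConsistent ks) ≤ e3JLevel ks ∧ hypOrderShen (smaxConsistent ks) = e3JLevel ks := by
  refine ⟨?_, ?_, ?_, ?_, ?_, ?_⟩ <;>
    simp only [hypOrderKS_def, smaxConsistent_def, gcmLevel_def, a4StrongOrder_def, jCanonLevel_def, frameOutOrder_def,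
      frameLevel_def, e3JLevel_def, hypOrderShen_def, kStar_def] <;> omega

/-- **`k_* − 4` is the only value of `s_max` compatible with both the supplied hypothesis order (8.5.6) and the displayed output order
`𝔥_{k_*−3}` of Steps 7/14.** [cite: KlainermanSzeftel2023, (8.5.6) HAL p.553, Step 7 p.563 L31–35, Step 14 p.573 L17–21] -/
theorem smax_unique (ks s : ℕ) : (hypOrderKS s ≤ gcmLevel ks ∧ frameOutOrder s = frameLevel ks) ↔ s = smaxConsistent ks := by
  simp only [hypOrderKS_def, gcmLevel_def, frameOutOrder_def, frameLevel_def, smaxConsistent_def, kStar_def]; omega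

/-- **The printed value is unsupported**: "s_max = k_small + k_* − 4" `= 2k_small + 16`; for `k_small ≥ 1` it exceeds the supply
`k_* − 4` of (8.5.6) (hypotheses (8.1.23)/(8.1.35) would ask for `sup|𝔡̸^{≤2k_small+16}(κ̇, κ̲̇, μ̇)|` resp. `𝔡̂^{≤2k_small+16}`), it is at least Step 1's `k_* − 3`
(everything available on ℳ^(extend)), strictly above it for `k_small ≥ 2`, and [Sh]'s printed demand `s_max + 1` exceeds `k_* − 3` already
for `k_small ≥ 1`. [cite: KlainermanSzeftel2023, HAL p.562 L54, p.563 L2, p.552 L5–6, p.553 L42; KlainermanSzeftel2021, l.21990, l.22010] -/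
theorem smaxPrinted_unsupported (ks : ℕ) (hks : 1 ≤ ks) :
    smaxPrinted ks = 2 * ks + 16 ∧ gcmLevel ks < hypOrderKS (smaxPrinted ks) ∧ extendLevel ks ≤ smaxPrinted ks ∧
    (2 ≤ ks → extendLevel ks < smaxPrinted ks) ∧ extendLevel ks < hypOrderShen (smaxPrinted ks) := by
  simp only [smaxPrinted_def, gcmLevel_def, hypOrderKS_def, extendLevel_def, hypOrderShen_def, kStar_def]; omega

/-- The two readings coincide only in the degenerate case `k_small = 0`; their difference is `k_small`. [folklore] -/
theorem smaxPrinted_eq_consistent_iff (ks : ℕ) :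
    (smaxPrinted ks = smaxConsistent ks ↔ ks = 0) ∧ smaxPrinted ks = smaxConsistent ks + ks := by
  simp only [smaxPrinted_def, smaxConsistent_def, kStar_def]; omega

/-- Under the printed value the displayed OUTPUTS would still be implied (item 7 / Thm 7.3 item 2 give MORE: `𝔥_{2k_small+17} ⊂ 𝔥_{k_*−3}`,
`⊂ 𝔥_{k_*−2}`) — the obstruction is on the hypothesis side only. [folklore] -/
theorem smaxPrinted_outputs_implied (ks : ℕ) :
    frameLevel ks ≤ frameOutOrder (smaxPrinted ks) ∧ (1 ≤ ks ↔ usDisplayed ks ≤ usOutOrder (smaxPrinted ks)) := by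
  simp only [frameLevel_def, frameOutOrder_def, smaxPrinted_def, usDisplayed_def, usOutOrder_def, kStar_def]; omega

/-! ## §4 Datum (ii): E11(b)-J at the Theorem-M7 application (Step 7, Step 14) -/

/-- STATEMENT LEVEL at M7: with `s_max = k_* − 4`, the [KS] demand (8.1.35) is met by (8.5.6) exactly; [Sh]'s printed (4.2) asks one more
(`k_* − 3`, which is Step 1's level, not (8.5.6)'s); [Sh] (4.1) on `e₃(J^{(p)})` is met exactly by Step 5.
[cite: KlainermanSzeftel2023, (8.1.34)–(8.1.35) HAL p.460 L60 – p.461 L13, (8.5.6) p.553; Shen2023GCM, (4.1)–(4.2) l.1773–1785] -/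
theorem e11b_at_M7 (ks : ℕ) :
    GCMHRungLedger.supplyKS (smaxConsistent ks) = gcmLevel ks ∧
    GCMHRungLedger.supplyShen (smaxConsistent ks) = gcmLevel ks + 1 ∧
    GCMHRungLedger.supplyShen (smaxConsistent ks) = extendLevel ks ∧
    GCMHRungLedger.demandE3J (smaxConsistent ks) ≤ e3JLevel ks ∧ hypOrderShen (smaxConsistent ks) ≤ e3JLevel ks := by
  refine ⟨?_, ?_, ?_, ?_, ?_⟩ <;>
    simp only [GCMHRungLedger.supplyKS_def, GCMHRungLedger.supplyShen_def, GCMHRungLedger.demandE3J_def, smaxConsistent_def,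
      gcmLevel_def, extendLevel_def, e3JLevel_def, hypOrderShen_def, kStar_def] <;> omega

/-- USE LEVEL at M7 — **Step 14 reads Shen's hierarchy only up to rung `K − 2`** (`K = s_max + 1 = k_* − 3`; (8.5.41) stops at
`k_* − 5 = K − 2` after Sobolev): a word `𝔡^k` with `j ≤ k` transversal derivatives is bounded pointwise by rung `j` with angular budget
`k − j + 2 ≤ K − j`.  The M6 pattern of `GCMHRungLedger.ks_reads_rungs_le`, verbatim. [cite: KlainermanSzeftel2023, (8.5.41), HAL p.573 L17–25] -/
theorem m7_reads_rungs_le (ks : ℕ) :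
    GCMHRungLedger.K (smaxConsistent ks) = frameLevel ks ∧
    supLevel14 ks = GCMHRungLedger.K (smaxConsistent ks) - GCMHRungLedger.sobolevCost ∧
    ∀ k j : ℕ, k ≤ supLevel14 ks → j ≤ k → k - j + GCMHRungLedger.sobolevCost ≤ GCMHRungLedger.K (smaxConsistent ks) - j := by
  refine ⟨?_, ?_, fun k j hk hj => ?_⟩
  · simp only [GCMHRungLedger.K_def, smaxConsistent_def, frameLevel_def, kStar_def]; omega
  · simp only [GCMHRungLedger.K_def, GCMHRungLedger.sobolevCost_def, smaxConsistent_def, supLevel14_def, kStar_def]; omega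
  · simp only [GCMHRungLedger.K_def, GCMHRungLedger.sobolevCost_def, smaxConsistent_def, supLevel14_def, kStar_def] at *; omega

/-- **Use-level discharge of E11(b)-J at M7**: every rung Step 14 reads (`l ≤ k_* − 5 = K − 2`) demands the background `(κ̇, κ̲̇, μ̇)` at
order `≤ s_max = k_* − 4` = the supply (8.5.6) (by `GCMHRungLedger.covered_by_KS_iff`), with one rung (`K − 1`) to spare; only the unread
top rung `K` would need `s_max + 1`. [cite: KlainermanSzeftel2023, HAL p.553, p.573; Shen2023GCM, l.2522–2602, l.3865–4046] -/
theorem m7_rungs_covered (ks l : ℕ) (hl : l ≤ supLevel14 ks + 1) :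
    GCMHRungLedger.demandKappa (GCMHRungLedger.K (smaxConsistent ks)) l ≤ GCMHRungLedger.supplyKS (smaxConsistent ks) ∧
    GCMHRungLedger.demandMuPrinted (GCMHRungLedger.K (smaxConsistent ks)) l ≤ GCMHRungLedger.supplyKS (smaxConsistent ks) ∧
    GCMHRungLedger.supplyKS (smaxConsistent ks) = gcmLevel ks ∧
    GCMHRungLedger.supplyKS (smaxConsistent ks) <
      GCMHRungLedger.demandKappa (GCMHRungLedger.K (smaxConsistent ks)) (supLevel14 ks + 2) := by
  have h := (GCMHRungLedger.covered_by_KS_iff (smaxConsistent ks) l).2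
    (by simp only [smaxConsistent_def, supLevel14_def, kStar_def] at hl ⊢; omega)
  refine ⟨h.1, h.2, ?_, ?_⟩
  · simp only [GCMHRungLedger.supplyKS_def, smaxConsistent_def, gcmLevel_def, kStar_def]
  · simp only [GCMHRungLedger.supplyKS_def, GCMHRungLedger.demandKappa_def, GCMHRungLedger.K_def, smaxConsistent_def,
      supLevel14_def, kStar_def]; omega

/-- BUDGET LEVEL — **M7 versus M6**: at Theorem M6 the descent from (8.4.4) lands on `k_large` with slack 0 (`GCMHRungLedger.repair_indices`),
so the index repair "(β): lower s_max by one" would cost a data index; at Theorem M7 the same repair (every level from Step 7 on drops by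
one, final `k_* − 13`) is absorbed by the printed slack 8. [cite: KlainermanSzeftel2023, §8.4 HAL p.535–550 vs §8.5 p.592 L48–53] -/
theorem m7_vs_m6_slack (ks kl : ℕ) :
    GCMHRungLedger.ksTopIndex kl - GCMHRungLedger.descentLoss = kl ∧ slack ks = 8 ∧ targetLevel ks ≤ finalLevel ks - 1 ∧
    frameOutOrder (smaxConsistent ks - 1) = frameLevel ks - 1 := by
  simp only [GCMHRungLedger.ksTopIndex_def, GCMHRungLedger.descentLoss_def, slack_def, targetLevel_def, finalLevel_def,
    frameOutOrder_def, smaxConsistent_def, frameLevel_def, kStar_def]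
  omega

/-! ## §5 Datum (iii): the Step-17 display `(U,S) ∈ 𝔥_{k_*−2}(S̊)` -/

/-- **(8.5.58) is one above what [GCM2] Thm 7.3 delivers** under the consistent reading: displayed `k_* − 2 = s_max + 2`, supplied
`s_max + 1 = k_* − 3`. [cite: KlainermanSzeftel2023, (8.5.58) HAL p.586 L26–30 vs Thm 8.1.7 item 2 p.458 L39–46; KlainermanSzeftel2022, l.3240–3244] -/
theorem us_display_excess (ks : ℕ) :
    usDisplayed ks = usOutOrder (smaxConsistent ks) + 1 ∧ usOutOrder (smaxConsistent ks) = kStar ks - 3 := by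
  simp only [usDisplayed_def, usOutOrder_def, smaxConsistent_def, kStar_def]; omega

/-- The Step-17 consumer of the `(U,S)` bound: pull back the metric (one derivative of `(U,S)`), apply Prop 4.15 at that index `s`
(output `φ̃ − φ∘Ψ^{−1} ∈ 𝔥_s(S̃_*)`), then Sobolev on `S̃_*` (−2): pointwise level `s − 2`. [cite: KlainermanSzeftel2023, HAL p.586 L31–60; KlainermanSzeftel2021, l.22838–22849] -/
def step17Sup (usOrder : ℕ) : ℕ := usOrder - pullbackLoss - GCMHRungLedger.sobolevCost

/-- Unfolding lemma. [folklore] -/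
@[simp] lemma step17Sup_def (usOrder : ℕ) : step17Sup usOrder = usOrder - pullbackLoss - GCMHRungLedger.sobolevCost := rfl

/-- **Fed with what Thm 7.3 supplies (`𝔥_{k_*−3}`), the Step-17 chain lands EXACTLY on the printed "k ≤ k_* − 6"** (Prop 4.15 at
`s = k_* − 4`, Sobolev to `k_* − 6`): the excess of (8.5.58) is not load-bearing. [cite: KlainermanSzeftel2023, HAL p.586 L43–50] -/
theorem us_chain_supplied (ks : ℕ) :
    usOutOrder (smaxConsistent ks) - pullbackLoss = kStar ks - 4 ∧ step17Sup (usOutOrder (smaxConsistent ks)) = step17SupLevel ks := by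
  simp only [usOutOrder_def, smaxConsistent_def, pullbackLoss_def, step17Sup_def, step17SupLevel_def, GCMHRungLedger.sobolevCost_def,
    kStar_def]
  omega

/-- Fed with the DISPLAYED `𝔥_{k_*−2}`, the same chain gives the displayed intermediate `𝔥_{k_*−3}(S̃_*)` (p.586 L43, L48) and would allow
`k ≤ k_* − 5`, one more than the text claims: local slack 1, which is exactly the excess. [cite: KlainermanSzeftel2023, HAL p.586 L43–50] -/
theorem us_chain_displayed (ks : ℕ) :
    usDisplayed ks - pullbackLoss = kStar ks - 3 ∧ step17Sup (usDisplayed ks) = step17SupLevel ks + 1 := by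
  simp only [usDisplayed_def, pullbackLoss_def, step17Sup_def, step17SupLevel_def, GCMHRungLedger.sobolevCost_def, kStar_def]; omega

/-! ## §6 Numerical witness (`k_small = 10`: `k_* = 30`, printed `s_max = 36`, consistent `s_max = 26`, final level `18`) -/

example : kStar 10 = 30 ∧ smaxPrinted 10 = 36 ∧ smaxConsistent 10 = 26 ∧ extendLevel 10 = 27 ∧ gcmLevel 10 = 26 ∧
    frameLevel 10 = 27 ∧ supLevel14 10 = 25 ∧ usDisplayed 10 = 28 ∧ usOutOrder 26 = 27 ∧ step17SupLevel 10 = 24 ∧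
    finalLevel 10 = 18 ∧ slack 10 = 8 ∧ GCMHRungLedger.K 26 = 27 := by decide

end Literature.Geometry.Lorentzian.KlainermanSzeftel2021.ExtensionRegularityLedger
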